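import Summits.NavierStokesRegularity.OSWSelfSimilar.SheetRCentreOfRecord
import Summits.NavierStokesRegularity.OSWSelfSimilar.CertificateViscousSheetRB
import HarnessLib

/-!
# SHEET-ℝ frame: the centre of record is NOT SMALL at `ξ = L = 8` — `|Ω̄(8)| > (√2/8)·rEBR2`, hypothesis-ledger row #9 as a kernel fact

HONEST FRAMING (cell ns-blowup GROUP B / zone Z3, cases Z3-SR-CERT / Z3-SR-SPEC; 1-D MODEL certificate frame; not Euler/NS; «violates: none —
MODEL»).  The end-to-end MODEL theorems (`SheetRCertificateCoercivity.modelBlowup_of_pointwise_certificate`, `SheetRSpectrumCertifiedProfile.certifiedProfile_word`)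
carry the hypothesis `hX₀ : (√2/8)·rEBR2 < |Ω̄(X₀)|` («the centre is not tiny at one point», so that the certified `Ω* = Ω̄ + O(rEBR2)` is not the zero
profile).  For the TYPED centre of record (`SheetRCentreOfRecord.centreOfRecord`, a frame combination in the Cayley angle `θ = 2arctan(ξ/8)`) the point
`X₀ = 8` is `θ = π/2`, where `cos θ = 0` and `sin(nθ) ∈ {0, 1, 0, −1}` by `n mod 4`; hence

  `Ω̄(8) = Σ_{i<767} d_{i+1}·χ(i + 1) + α₂/(2√2)`,  `χ = (0, 1, 0, −1)` periodically,

an EXACT RATIONAL (`≈ −0.24031`, evaluated in the kernel by `decide` on the data table: `sumAtEight_lt`) plus a NEGATIVE closed-form term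
(`α₂ < 0`), so `|Ω̄(8)| > 0.24 > (√2/8)·rEBR2 ≈ 9.3·10⁻⁷` (**`rEBR2_lt_abs_centreOfRecord_eight`**).  No definition beyond the computable rational
bookkeeping `chiQ` / `coeffQ` / `sumAtEight`; no named fact.  WHAT THIS IS NOT: not NS; not an interval evaluation of `Ω̄` anywhere else; no certificate
number is re-derived.
-/

noncomputable section

namespace Summit.NavierStokesRegularity.OSWSelfSimilar
namespace SheetRCentreOfRecordValue

open _root_.Real SheetRFrameCentre SheetRCentreOfRecord CertificateViscousSheetR

/-! ### §1 The rational bookkeeping at `ξ = 8` -/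

/-- `χ(n) = sin(nπ/2) ∈ {0, 1, 0, −1}` as a rational, by `n mod 4`. [folklore] -/
def chiQ (n : ℕ) : ℚ := if n % 4 = 1 then 1 else if n % 4 = 3 then -1 else 0

/-- The `i`-th frame coefficient as a rational: `d_{i+1} = p/2^e`. [folklore] -/
def coeffQ (i : ℕ) : ℚ := mkRat (centreFrameTable.getD i (0, 0)).1 (2 ^ (centreFrameTable.getD i (0, 0)).2)

/-- The frame part of `Ω̄(8)`: `Σ_{i<767} d_{i+1}·χ(i+1)`, as a computable rational (list form). [folklore] -/
def sumAtEight : ℚ := ((List.range 767).map fun i => coeffQ i * chiQ (i + 1)).sum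

/-- **Kernel evaluation**: the frame part of `Ω̄(8)` is `< −6/25` (it equals `−304633597547085834244205866429/2¹⁰⁰ ≈ −0.24031`). [folklore] -/
theorem sumAtEight_lt : sumAtEight < -(6 / 25) := by
  decide +kernel

/-- The real coefficient is the cast of the rational one. [folklore] -/
theorem centreCoeff_eq_cast (i : ℕ) : centreCoeff i = ((coeffQ i : ℚ) : ℝ) := by
  rw [centreCoeff, coeffQ, Rat.cast_mkRat_of_ne_zero _ (by positivity)]
  push_cast
  rfl

/-- `Finset.range` sums are `List.range` sums. [folklore] -/
theorem sum_range_eq_list_sum (f : ℕ → ℝ) (n : ℕ) : ∑ i ∈ Finset.range n, f i = ((List.range n).map f).sum := by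
  induction n with
  | zero => simp
  | succ n ih => rw [Finset.sum_range_succ, ih, List.range_succ, List.map_append, List.sum_append]; simp

/-- `sin(n·π/2) = χ(n)`. [folklore] -/
theorem sin_nat_mul_pi_div_two (n : ℕ) : Real.sin (n * (π / 2)) = ((chiQ n : ℚ) : ℝ) := by
  -- reduce to `n % 4` using the period `4·(π/2) = 2π`
  have hper : ∀ m : ℕ, Real.sin (((m + 4 : ℕ) : ℝ) * (π / 2)) = Real.sin ((m : ℝ) * (π / 2)) := by
    intro m
    rw [show (((m + 4 : ℕ) : ℝ)) * (π / 2) = (m : ℝ) * (π / 2) + 2 * π by push_cast; ring, Real.sin_add_two_pi]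
  have hchi : ∀ m : ℕ, chiQ (m + 4) = chiQ m := by
    intro m; simp [chiQ, Nat.add_mod_right]
  induction n using Nat.strong_induction_on with
  | _ n ih =>
    rcases lt_or_ge n 4 with hn | hn
    · interval_cases n
      · simp [chiQ]
      · simp [chiQ, Real.sin_pi_div_two]
      · rw [show ((2 : ℕ) : ℝ) * (π / 2) = π by push_cast; ring, Real.sin_pi]; simp [chiQ]
      · rw [show ((3 : ℕ) : ℝ) * (π / 2) = π / 2 + π by push_cast; ring, Real.sin_add_pi, Real.sin_pi_div_two]
        simp [chiQ]
    · obtain ⟨m, rfl⟩ : ∃ m, n = m + 4 := ⟨n - 4, by omega⟩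
      rw [hper, hchi, ih m (by omega)]

/-! ### §2 The value at `ξ = 8` -/

/-- `θ(8) = 2arctan(8/8) = π/2`. [folklore] -/
theorem cayleyAngle_eight : 2 * arctan ((8 : ℝ) / 8) = π / 2 := by
  rw [div_self (by norm_num : (8 : ℝ) ≠ 0), Real.arctan_one]; ring

/-- `e_n(8) = sin(nπ/2)`. [folklore] -/
theorem frame_eight (n : ℕ) : frame 8 n 8 = Real.sin (n * (π / 2)) := by
  rw [frame, cayleyAngle_eight, Real.cos_pi_div_two, add_zero, one_mul]

/-- `8²·T₂(8) = 1/(2√2)` (positive). [folklore] -/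
theorem farT2_eight : (8 : ℝ) ^ 2 * farT2 8 8 = 1 / (2 * √2) := by
  rw [farT2]
  have h128 : √((8 : ℝ) ^ 2 + 8 ^ 2) = 8 * √2 := by
    rw [show (8 : ℝ) ^ 2 + 8 ^ 2 = 8 ^ 2 * 2 by norm_num, Real.sqrt_mul (by norm_num), Real.sqrt_sq (by norm_num)]
  rw [h128]
  have h2 : (0 : ℝ) < √2 := Real.sqrt_pos.2 (by norm_num)
  field_simp
  norm_num

/-- The frame sum at `ξ = 8` is the cast of the rational bookkeeping sum. [folklore] -/
theorem frameSum_eight : (∑ i ∈ Finset.range 767, centreCoeff i * frame 8 (i + 1) 8) = ((sumAtEight : ℚ) : ℝ) := by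
  have hlist : (List.range 767).map (fun i => centreCoeff i * frame 8 (i + 1) 8)
      = (List.range 767).map (fun i => (((coeffQ i * chiQ (i + 1) : ℚ)) : ℝ)) := by
    refine List.map_congr_left fun i _ => ?_
    rw [Rat.cast_mul, ← centreCoeff_eq_cast, frame_eight, ← sin_nat_mul_pi_div_two (i + 1), Nat.cast_add, Nat.cast_one]
  rw [sum_range_eq_list_sum, hlist, sumAtEight, Rat.cast_list_sum, List.map_map]
  rfl

/-- **The value at `ξ = 8`**: `Ω̄(8) = Σ_{i<767} d_{i+1}χ(i+1) + α₂/(2√2)`. [folklore] -/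
theorem centreOfRecord_eight : centreOfRecord 8 = ((sumAtEight : ℚ) : ℝ) + centreAlpha2 * (1 / (2 * √2)) := by
  have h : centreOfRecord 8 = (∑ i ∈ Finset.range 767, centreCoeff i * frame 8 (i + 1) 8) + centreAlpha2 * ((8 : ℝ) ^ 2 * farT2 8 8) := rfl
  rw [h, frameSum_eight, farT2_eight]

/-- `α₂ < 0`. [folklore] -/
theorem centreAlpha2_neg : centreAlpha2 < 0 := by
  rw [centreAlpha2]
  exact div_neg_of_neg_of_pos (by norm_num) (by positivity)

/-- **`Ω̄(8) < −6/25`**: the frame part is `< −6/25` (kernel) and the far-field part `α₂/(2√2)` is negative. [folklore] -/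
theorem centreOfRecord_eight_lt : centreOfRecord 8 < -(6 / 25) := by
  rw [centreOfRecord_eight]
  have h1 : ((sumAtEight : ℚ) : ℝ) < -(6 / 25) := by
    have h := (Rat.cast_lt (K := ℝ)).2 sumAtEight_lt
    have e : (((-(6 / 25) : ℚ)) : ℝ) = -(6 / 25) := by push_cast; ring
    rwa [e] at h
  have h2 : centreAlpha2 * (1 / (2 * √2)) < 0 :=
    mul_neg_of_neg_of_pos centreAlpha2_neg (by positivity)
  linarith

/-- **HYPOTHESIS-LEDGER ROW #9 FOR THE CENTRE OF RECORD**: `(√2/8)·rEBR2 < |Ω̄(8)|` (`rEBR2 = 1321/250000000`, so the left side is `< 10⁻⁶`,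
while `|Ω̄(8)| > 6/25`). [folklore] -/
theorem rEBR2_lt_abs_centreOfRecord_eight : Real.sqrt 2 / 8 * ((rEBR2 : ℚ) : ℝ) < |centreOfRecord 8| := by
  have h1 : centreOfRecord 8 < -(6 / 25) := centreOfRecord_eight_lt
  have h2 : (6 / 25 : ℝ) < |centreOfRecord 8| := by
    rw [abs_of_neg (by linarith)]; linarith
  refine lt_trans ?_ h2
  have hs : Real.sqrt 2 ≤ 2 := by
    rw [show (2 : ℝ) = Real.sqrt 4 by rw [show (4:ℝ) = 2 ^ 2 by norm_num, Real.sqrt_sq (by norm_num)]]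
    exact Real.sqrt_le_sqrt (by norm_num)
  have hr : ((rEBR2 : ℚ) : ℝ) = 1321 / 250000000 := by rw [rEBR2]; push_cast; ring
  rw [hr]
  nlinarith [Real.sqrt_nonneg 2]

end SheetRCentreOfRecordValue
end Summit.NavierStokesRegularity.OSWSelfSimilar

end
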